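import Mathlib
import HarnessLib
import HarnessLib.Audit
import Summits.HodgeConjecture.Statement
import Literature.AlgebraicTopology.SingularHomology.CohomologyRingChange
import HarnessLib.Audit.Status.Attr

/-!
Route: GenericDivisibility

DORMANT since 2026-08-25T15:22:05Z (reconciler: no traction for 7.8 d (last activity item-evidence-added at 2026-08-17T19:18:25Z); parked, not closed — `ledger route dormant route-HodgeConjecture-GenericDivisibility --off` to reactivate) — unstaffed, not closed; items shared with open routes are served there. `ledger route dormant <id> --off` reactivates.

# Route GenericDivisibility — HC splits at finite coefficients — middle-degree Hodge classes are
divisible on Zariski opens, and generic divisibility is bounded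

It suffices to show X = C1 ∧ C2, two statements about INTEGRAL singular cohomology H^{2p}(X(ℂ);ℤ) in
the MIDDLE degree of a
smooth projective complex 2p-fold X (p ≥ 1), restricted to the complex points of non-empty Zariski
opens X ∖ Z (Z closed ≠ X):
C1 (HodgeClassesGenericallyDivisible): an integral class z whose complexification is of Hodge type
(p,p) is, for every m ≥ 1,
divisible by m on some non-empty Zariski open — equivalently z mod m has coniveau ≥ 1 with
ℤ/m-coefficients, i.e. the unramified
class of z in H^{2p}_nr(X;ℤ/m) ⊂ H^{2p}(ℂ(X), μ_m^{⊗2p}) ≅ K^M_{2p}(ℂ(X))/m (Bloch–Kato) vanishes.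
C2 (GenericDivisibilityBounded,
Hodge-free): an integral middle-degree class divisible by every m on non-empty Zariski opens has
complexification of coniveau ≥ 1
(it dies on a non-empty Zariski open). Lens recombination-sharpened: the parents are the tree's
PROVED pencil step, hard-Lefschetz
reduction and supported-Hodge-class descent; C1, C2 are the only new joints.
Lean: `HodgeClassesGenericallyDivisible ∧ GenericDivisibilityBounded`

## Assembly
Strong induction on n = dim X (`closes`, sorry-free, elaborates against the Statement +
CohomologyRingChange alone; route-repair
2026-08-17 moved every proved engine out of the file into SHARED, already PROVED support items):
Hodge models by HodgeModelsExist
(stmt-2742, proved); degree 2p < n by PencilReduction (stmt-1083, proved; inner induction on p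
inside dimension n); degree 2p > n by
HardLefschetzReduction (stmt-1084, proved) fed codimension n − p, which is below the middle or zero
(`hodgeConjectureFor_codim_zero`);
degree 2p = n: p = 0 is `hodgeConjectureFor_codim_zero`, and for p ≥ 1 the two cruxes give coniveau
≥ 1 (support MiddleConiveauOne,
provable now) and DivisorInduction (stmt-1082, proved: supported rational (p,p) classes on an
(m+1)-fold are algebraic granted HC in
codimension p − 1 for m-folds, supplied by the induction hypothesis) gives algebraicity.

Rationale: WHY THIS LINE. HC is equivalent to "every rational (p,p) class has coniveau ≥ 1" run through the
dimension induction (Deligne Hodge III 8.2.8 +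
Voisin's semisimplicity lift; tree: `supportedHodgeClassDescent_of_deligne_voisin`, route
HolomorphicDefect; the pencil step
`mem_algebraicClasses_of_two_mul_le`, DecataldoMigliorini2009;
`linearSystemTorelli_hardLefschetzReduction_proof`, route
LinearSystemTorelli — all proved), and only the middle degree of even-dimensional varieties is left.
We cut that residual
coniveau-one statement along the ℓ-ADIC SEAM imported from algebraic K-theory / motivic cohomology:
by the Bloch–Kato conjecture
(Voevodsky–Rost) the Zariski sheaves 𝓗^q(ℤ) are torsion-free (Colliot-Thélène–Voisin,
arXiv:1005.2778, Thm. 3.1), so HC implies C1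
on the nose (no multiple needed), and C1 is a statement about a Galois-symbol group of the function
field, stable under
specialisation, birational modification and finite-coefficient base change; the complement C2
contains no Hodge theory at all —
it says the "generic lattice" of integral classes becoming integral on opens is a lattice modulo
coniveau one, whose odd-degree
shadow (degree 3 ⟺ no ℚ_ℓ/ℤ_ℓ in Griff²_tors) is a theorem (Merkurjev–Suslin, quoted in Schreieder
arXiv:2011.15047 §1). No open
route works with finite or integral coefficients at the generic point: HolomorphicDefect reaches
coniveau one by gauge theory,
LinearSystemTorelli / LimitExtension by nodal divisors, MilnorKExponential (opened today) by
ANALYTIC Milnor K-sheaves and the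
Hodge filtration; the negatives index (Fermat multisets, E-line matrices) is untouched.

RANKED CRUXES. #2 HodgeClassesGenericallyDivisible (crux) — for p ≥ 1, X smooth projective of
dimension 2p over ℂ and an integral class z ∈ H^{2p}(X(ℂ);ℤ) whose image in H^{2p}(X(ℂ);ℂ) is of
Hodge type (p,p): for every m ≥ 1 there are a Zariski-closed Z ⊊ X and an integral class y on
(X∖Z)(ℂ) with m•y = z|_{(X∖Z)(ℂ)} ("Hodge classes are unramified-invisible": the mod-m reduction of
z has coniveau ≥ 1; first open case p = 2, the image of Hdg⁴(X,ℤ) in H⁴_nr(X,ℤ/m)). [difficulty: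
open-problem] (why it might fail: HC-implied only granted Bloch–Kato (𝓗^{2p}(ℤ) torsion-free); false
iff some middle Hodge class has non-zero symbol in H^{2p}_nr(X,ℤ/ℓ^r) ∀ opens — a Hodge
counterexample detected at finite level (e.g. on a HK/CY fourfold).) [arXiv:1005.2778,
doi:10.1007/bf01446296, doi:10.1017/s1474748014000401, doi:10.4007/annals.2011.174.1.11,
DeligneHodgeIII1974]
#3 GenericDivisibilityBounded (crux) — for p ≥ 1 and X smooth projective of dimension 2p over ℂ, an
integral class z ∈ H^{2p}(X(ℂ);ℤ) that is divisible by every m ≥ 1 on the complex points of some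
non-empty Zariski open (depending on m) has complexification in N¹H^{2p}(X(ℂ);ℂ) = supportedClasses
X (2p) 1 (no ℓ-divisible phantom at the generic point: im(H^{2p}(X;ℤ) → H^{2p}_nr(X;ℤ)) meets the
divisible subgroup in 0). Hodge-free; true in degrees ≤ 2 (Kummer/Brauer) and in degree 3
(finiteness of Griff²_tors, Merkurjev–Suslin); first open case degree 4 on fourfolds. [difficulty:
open-problem] (why it might fail: torsion of unbounded order in H^{2p+1}_Z(X;ℤ) ≅ H^BM(Z) over
divisors Z may assemble into an ℓ-divisible chain in (H^{2p}_nr(X;ℤ)/H^{2p}(X;ℤ))_tors ⊂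
H²(X,𝓗^{2p-1}(ℤ)) (cf. infinite torsion phenomena, arXiv:2011.15047).) [arXiv:1005.2778,
arXiv:2011.15047, arXiv:2010.05814, doi:10.1090/s0894-0347-97-00232-4, doi:10.24033/asens.1266]
#9 MiddleConiveauOne (support) — the seam (provable now; proved in the planner's Sketch.lean as
`middleConiveauOne`, 10 lines): C1 and C2 give coniveau ≥ 1 for every RATIONAL middle-degree (p,p)
class — take an integral multiple (IsRationalClass.exists_nsmul_isIntegralClass,
isIntegralClass_iff_mem_range_ringChange), apply C1 then C2, divide by the multiple in the
ℂ-submodule N¹. [difficulty: provable-now] [VoisinHodgeI2002, HatcherAT2002]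
#9 TorsionDiesGenerically (support) — the Bloch–Kato shadow used by every line on C1 (printed
theorem, Colliot-Thélène–Voisin 2012 Thm. 3.1: the Zariski sheaf 𝓗^{2p}(ℤ) is torsion-free): an
integral class on the complex points of a non-empty Zariski open of a smooth projective 2p-fold that
is killed by some N ≥ 1 restricts to zero on the complex points of a smaller non-empty Zariski open.
Not in Mathlib or the tree (needs the norm-residue theorem); filed as a cite request. [difficulty:
L] [arXiv:1005.2778, doi:10.4007/annals.2011.174.1.11, doi:10.24033/asens.1266]
#9 HodgeModelsExist · DivisorInduction · PencilReduction · HardLefschetzReduction (support, SHARED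
and already PROVED in the tree: stmt-2742 holomorphicDefect_hodgeModelsExist_proof, stmt-1082
nodalSupport_divisorInduction_proof, stmt-1083 linearSystemTorelli_pencilReduction_proof, stmt-1084
linearSystemTorelli_hardLefschetzReduction_proof) — the known engines of the dimension induction,
re-asked with their shared signatures verbatim so that `closes` consumes items only and the route
file imports nothing but the Statement and CohomologyRingChange (route-repair 2026-08-17, cone
guardrail: import closure 2685 → 52 modules; all 181 unproved cone facts rode in on the
proof-carrying imports of the old in-file induction — PencilStepBelowMiddleHolds,
SaitoGrFDeRhamCurveNetHolds, HodgeTypeConjugation, ComplexConjugationHolds, RationalLatticeIntegral,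
IntegralClassesCountable, the two Theorems files — none of which any crux uses).
TorsionDiesGenerically was restated 1:1 (Iff.rfl-identical) with the inclusion (X∖Z')(ℂ) ↪ (X∖Z)(ℂ)
spelled inline instead of `complexPointsComplInclusion`, whose module drags AlgebraicClassesCup.
[difficulty: proved ×4] [DeligneHodgeIII1974, Thomas2005Nodes, VoisinHodgeI2002, VoisinHodgeII2003,
SerreGAGA1956]

TWO-LAYER PLAN. Foreseen glued splits (birth skeletons bc/*_birth.lean, to be published as
Lines/birth.lean): HodgeClassesGenericallyDivisible ⇐
TorsionDiesGenerically → HodgeDivisibleModTorsion (z|_U ≡ m•y up to a torsion class) → C1;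
GenericDivisibilityBounded ⇐
GenericDenominatorBound (∃ e(X) ≥ 1: m-divisible on an open ⇒ e•z ≡ m•w modulo a generically-trivial
class) →
ConiveauOfDivisibleModConiveau (finite generation of H^{2p}(X(ℂ);ℤ): divisible modulo coniveau one ⇒
torsion modulo coniveau one)
→ C2. Later, per line: C1 on fourfolds via specialisation of z mod ℓ^r to good reduction over
finitely generated fields (étale,
proper–smooth base change) and unramified cohomology of the special fibre; C2 via the Bloch–Ogus /
refined-unramified exact
sequences in degree 4 (H⁴_nr(ℤ)/H⁴ ↪ H²(X,𝓗³(ℤ)), torsion ← H¹(X,𝓗³(ℤ/ℓ^r)) ≅ N¹H⁴(X;ℤ/ℓ^r)/N²).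

KILL CRITERIA. ¬GenericDivisibilityBounded — an integral middle-degree class (necessarily
transcendental or a genuine Hodge counterexample)
ℓ^r-divisible on opens for all r yet of coniveau 0 — closes the route
`refuted:GenericDivisibilityBounded` (the seam is then
wrong; C1 survives as a consequence of HC and goes to the wuc list).
¬HodgeClassesGenericallyDivisible is, granted Bloch–Kato, a
counterexample to the Hodge conjecture detected at FINITE level: hand the witness to the negative
side (it refutes HC outright once
TorsionDiesGenerically lands). A proof of C2 alone converts the route into the reformulation record
"HC ⟺ Hodge classes are
unramified-invisible"; HC proved elsewhere moots it.

NOT DECOMPOSED YET. The fourfold instance (p = 2: Hdg⁴(X,ℤ) → H⁴_nr(X,ℤ/ℓ^r), and the bounded-depth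
statement for H⁴) is not filed separately — it
is the first rung of both cruxes and will be the first split child once a line registers; no items
for the Bloch–Ogus /
Gersten vocabulary (𝓗^q sheaves, unramified cohomology, Galois symbol), which are definition
requests; no arithmetic
specialisation statement (finite fields) until the étale comparison with finite coefficients has
carriers; the odd-degree and
below-middle analogues of C2 (degree 3 is a theorem) are deliberately excluded — `closes` consumes
only degree 2p = dim X.

CHEAPEST FALSIFIER. C2 at (dim, degree) = (4, 4) on a product S × S' of surfaces with p_g ≥ 1 or on
an abelian fourfold: compute whether
(H⁴_nr(X;ℤ)/H⁴(X;ℤ))_tors can contain ℚ_ℓ/ℤ_ℓ, via the exact sequence H¹(X,𝓗³(ℤ/ℓ^r)) ≅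
N¹H⁴(X;ℤ/ℓ^r)/N²H⁴ ↠ H²(X,𝓗³(ℤ))[ℓ^r]
(Bloch–Ogus + CT–Voisin Thm 3.1): if the corank of N¹H⁴(X;ℚ_ℓ/ℤ_ℓ) exceeds rank N¹H⁴(X;ℤ), C2 is
false there. A literature
lookup that would settle it either way: Schreieder's refined unramified cohomology (arXiv:2010.05814
§7) — does it identify
lim_r N¹H^{2p}(X;ℤ/ℓ^r) with N¹H^{2p}(X;ℤ)⊗ℤ_ℓ up to bounded torsion? I could not run it (paper not
materialised in this session:
arXiv rate-limited); degree ≤ 3 checks done by hand (true).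

NUMBERS. Known: degree 2 (Lefschetz (1,1): N¹H²(X;ℤ/m) = NS/m, Kummer); degree 3: Griff²(X)_tors
finite (Merkurjev–Suslin; Schreieder
arXiv:2011.15047 §1) ⇒ the degree-3 analogue of C2 holds for every X; CT–Voisin Thm 3.7: 0 →
H³_nr(X,ℤ)/n → H³_nr(X,μ_n^{⊗2}) →
Z⁴(X)[n] → 0; first open case of both cruxes: (dim X, degree) = (4, 4). Items at open: 5 (2 cruxes,
2 supports, 1 assembly); after route-repair 2026-08-17: 9 (2 cruxes, 6 supports of which 4 shared &
proved, 1 assembly).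

DEFINITION REQUESTS. (1) cite fact (Literature/AlgebraicGeometry/Motives or HodgeTheory):
Colliot-Thélène–Voisin 2012 Thm. 3.1 — for a smooth complex
variety the Zariski sheaves 𝓗^q_X(ℤ(i)) (sheafification of U ↦ H^q(U(ℂ);ℤ)) are torsion-free (from
Bloch–Kato/Voevodsky–Rost);
real-carrier corollary = the support item TorsionDiesGenerically. (2) notion UnramifiedCohomology
(H^q_nr(X,A) = H⁰(X_Zar, 𝓗^q(A)))
with the Bloch–Ogus identification N¹H^q = ker(H^q(X;A) → H^q_nr(X;A)) for A = ℤ, ℤ/m. Filed after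
open with `ledger workitem add`.

Novelty: Searches (2026-08-17): `lit search --source zbmath/crossref "coniveau filtration non-divisibility
algebraic cycles Bloch Esnault"` (1:
doi:10.1007/bf01446296 + Voisin JOMP 2025 survey doi:10.56994/jomp.001.001.002); `lit read
arxiv:1005.2778 --grep torsion` (CT–Voisin,
Thm 3.1/3.7 read pp. 7–10); `lit search --source zbmath "Schoen torsion Griffiths group"`,
`"Schreieder infinite torsion Griffiths
groups"` (doi:10.4171/jems/1419, read §1: "By [MS] the torsion subgroup of Griff² is finite"),
`"Totaro Chow groups modulo 2"`
(doi:10.4007/annals.2016.183.1.7); `lean search 'unramified|BlochKato|MilnorK' --decl` (483 hits,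
none on unramified cohomology /
norm residue); bridges.json 80 rows (no K-theory bridge); open-route census (38 routes; nearest
MilnorKExponential, HolomorphicDefect).
OpenAlex/S2/arXiv APIs rate-limited this session (recorded). Nearest prior art found:
Colliot-Thélène–Voisin arXiv:1005.2778 §3
(unramified H³ with finite coefficients ⟷ integral Hodge defect Z⁴; torsion-freeness of 𝓗^q(ℤ));
Bloch–Esnault
doi:10.1007/bf01446296 (coniveau with ℤ/ℓ-coefficients is SMALL on very general complete
intersections ⇒ non-divisibility of cycle
classes); Rosenschon–Srinivas doi:10.1017/s1474748014000401 (HC_ℚ ⟺ integral L-Hodge conjecture in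
étale-motivic cohomology);
Schreieder arXiv:2010.05814 / arXiv:2011.15047 (refined unramified cohomology computes torsion cycle
groups). In-tree nearest:
route MilnorKExponential (analytic Milnor-K symbol classes L^p, Hodge-filtration si  [refs: 10.1007/bf01446296, 10.56994/jomp.001.001.002, 10.4171/jems/1419, 10.4007/annals.2016.183.1.7, 10.1017/s1474748014000401, 1005.2778, 2010.05814, 2011.15047, doi:10.1007/bf01446296, doi:10.56994/jomp.001.001.002, arxiv:1005.2778, doi:10.4171/jems/1419, doi:10.4007/annals.2016.183.1.7, doi:10.1017/s1474748014000401]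

Barriers (technique_class: coniveau-induction, finite-coefficients, unramified-coh): - technique_class: coniveau-induction, finite-coefficients, unramified-coh
- Literature.Barriers.HodgeConjecture.AtiyahHirzebruch1962_torsionClass_notAlgebraic: evaded by
working GENERICALLY — a torsion integral class is torsion on every Zariski open and dies on a
smaller one (Bloch–Kato torsion-freeness of 𝓗^{2p}(ℤ), CT–Voisin Thm 3.1), so Atiyah–Hirzebruch
classes satisfy C1 and C2; the cruxes never ask for an integral cycle, only divisibility on opens
and RATIONAL coniveau.
- Literature.Barriers.HodgeConjecture.Kollar1992_nonTorsionClass_notAlgebraic: same evasion —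
Kollár's α with ℓα algebraic: ℓα dies off its cycle, so α is ℓ-torsion on that open and dies on a
smaller open; C1 holds for it (and Kollár's threefold examples are outside the
middle-degree-of-even-dimension scope anyway).
- Literature.Barriers.HodgeConjecture.Grothendieck1969_generalHodgeConjecture_false: not met — both
cruxes concern (p,p) CLASSES (level 0), where coniveau ≥ 1 is implied by HC itself; no
sub-Hodge-structure / level statement à la GHC is asserted.
- Literature.Barriers.HodgeConjecture.Grothendieck1969_hodgeGeneralConjecture_false_abstract: same —
the abstract parity obstruction lives in odd weight; the line asserts nothing about odd-degree or
positive-level substructures.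
- Literature.Barriers.HodgeConjecture.Clemens1983_griffithsGroup_infiniteRank: it bites C2 only
through DIVISIBLE TORSION, not rank: infinite rank of Griff ⊗ ℚ (Clemens) and infinitely many
torsion elements (Schreieder, codi

History (route lifecycle, newest last):
- 2026-08-17T03:03:35Z · rev 1: restated TorsionDiesGenerically (stmt-HodgeConjecture-18469) — route-repair (cone guardrail) 2026-08-17: reroute around 181 unproved cone facts — they all rode in on the proof-carrying imports of the old in-file induction; (planner-rrepair-HodgeConjecture-GenericDivisib-fa905b40-0)
- 2026-08-25T15:22:05Z · DORMANT — reconciler: no traction for 7.8 d (last activity item-evidence-added at 2026-08-17T19:18:25Z); parked, not closed — `ledger route dormant route-HodgeConjecture- (operator:999:107897)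

sub-problem: HodgeConjecture · status: dormant · opened planner-plan-lens3-HodgeConjecture-recomb2-g2-0 2026-08-17T02:36:09Z · rev 1 · ledger route-HodgeConjecture-GenericDivisibility
GENERATED by the gate from the ledger (D-0016/17). Provers cite these decls: `theorem foo : Summit.HodgeConjecture.HodgeConjecture.Theses.GenericDivisibility.<Decl> := …` in Summits/HodgeConjecture/HodgeConjecture/Theorems/<Name>.lean.
-/

namespace Summit.HodgeConjecture.HodgeConjecture.Theses.GenericDivisibility

open scoped BigOperators Topology Manifold Classical MeasureTheory ProbabilityTheory Matrix InnerProductSpace ComplexConjugate ContinuousMap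
open Filter Set Function TopologicalSpace MeasureTheory

attribute [summit_statement] _root_.HodgeConjecture

/-- item stmt-HodgeConjecture-18466 · crux · rank 2 · open · by planner
why it might fail: HC-implied only granted Bloch–Kato (𝓗^{2p}(ℤ) torsion-free); false iff some middle Hodge class has non-zero symbol in H^{2p}_nr(X,ℤ/ℓ^r) ∀ opens — a Hodge counterexample detected at finite level (e.g. on a HK/CY fourfold).
sources: arXiv:1005.2778, doi:10.1007/bf01446296, doi:10.1017/s1474748014000401, doi:10.4007/annals.2011.174.1.11, DeligneHodgeIII1974
[crux] for p ≥ 1, X smooth projective of dimension 2p over ℂ and an integral class z ∈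
H^{2p}(X(ℂ);ℤ) whose image in H^{2p}(X(ℂ);ℂ) is of Hodge type (p,p): for every m ≥ 1 there are a
Zariski-closed Z ⊊ X and an integral class y on (X∖Z)(ℂ) with m•y = z|_{(X∖Z)(ℂ)} ("Hodge classes
are unramified-invisible": the mod-m reduction of z has coniveau ≥ 1; first open case p = 2, the
image of Hdg⁴(X,ℤ) in H⁴_nr(X,ℤ/m)). [difficulty: open-problem] -/
@[route_item "route-HodgeConjecture-GenericDivisibility", crux]
def HodgeClassesGenericallyDivisible : Prop :=
  open Literature.AlgebraicGeometry.Motives Literature.AlgebraicGeometry.HodgeTheory Literature.AlgebraicTopology.SingularHomology in ∀ ⦃p : ℕ⦄ ⦃X : SchemeOver ℂ⦄, 1 ≤ p → IsSmoothProjective (2 * p) X → ∀ z : singularCohomology ℤ ℤ (ComplexPoints X) (2 * p), IsOfHodgeType (2 * p) X (2 * p) p p (singularCohomology.ringChange (Int.castRingHom ℂ) (ComplexPoints X) (2 * p) z) → ∀ m : ℕ, 1 ≤ m → ∃ Z : Set X.left, IsClosed Z ∧ Z ≠ Set.univ ∧ ∃ y : singularCohomology ℤ ℤ (complexPointsCompl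 X Z) (2 * p), m • y = singularCohomology.map ℤ ℤ (⟨Subtype.val, continuous_subtype_val⟩ : C(complexPointsCompl X Z, ComplexPoints X)) (2 * p) z

/-- item stmt-HodgeConjecture-18467 · crux · rank 3 · open · by planner
why it might fail: torsion of unbounded order in H^{2p+1}_Z(X;ℤ) ≅ H^BM(Z) over divisors Z may assemble into an ℓ-divisible chain in (H^{2p}_nr(X;ℤ)/H^{2p}(X;ℤ))_tors ⊂ H²(X,𝓗^{2p-1}(ℤ)) (cf. infinite torsion phenomena, arXiv:2011.15047).
sources: arXiv:1005.2778, arXiv:2011.15047, arXiv:2010.05814, doi:10.1090/s0894-0347-97-00232-4, doi:10.24033/asens.1266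
[crux] for p ≥ 1 and X smooth projective of dimension 2p over ℂ, an integral class z ∈
H^{2p}(X(ℂ);ℤ) that is divisible by every m ≥ 1 on the complex points of some non-empty Zariski open
(depending on m) has complexification in N¹H^{2p}(X(ℂ);ℂ) = supportedClasses X (2p) 1 (no
ℓ-divisible phantom at the generic point: im(H^{2p}(X;ℤ) → H^{2p}_nr(X;ℤ)) meets the divisible
subgroup in 0). Hodge-free; true in degrees ≤ 2 (Kummer/Brauer) and in degree 3 (finiteness of
Griff²_tors, Merkurjev–Suslin); first open case degree 4 on fourfolds. [difficulty: open-problem] -/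
@[route_item "route-HodgeConjecture-GenericDivisibility", crux]
def GenericDivisibilityBounded : Prop :=
  open Literature.AlgebraicGeometry.Motives Literature.AlgebraicGeometry.HodgeTheory Literature.AlgebraicTopology.SingularHomology in ∀ ⦃p : ℕ⦄ ⦃X : SchemeOver ℂ⦄, 1 ≤ p → IsSmoothProjective (2 * p) X → ∀ z : singularCohomology ℤ ℤ (ComplexPoints X) (2 * p), (∀ m : ℕ, 1 ≤ m → ∃ Z : Set X.left, IsClosed Z ∧ Z ≠ Set.univ ∧ ∃ y : singularCohomology ℤ ℤ (complexPointsCompl X Z) (2 * p), m • y = singularCohomology.map ℤ ℤ (⟨Subtype.val, continuous_subtype_val⟩ : C(complexPointsCompl X Z, ComplexPoints X)) (2 * p) z) → singularCohomology.ringChange (Int.castRingHom ℂ) (ComplexPoints X) (2 * p) z ∈ supportedClasses X (2 * p) 1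

/-- item stmt-HodgeConjecture-18143 · support · rank 9 · closed · proved by Summit.HodgeConjecture.HodgeConjecture.Theorems.genericDivisibility_hodgeModelsExist_proof @ 8e7689d4c59e (prover) · by planner
sources: SerreGAGA1956, VoisinHodgeI2002, Deligne2000
[support] every smooth projective complex variety of dimension n has a Hodge model — the
anti-vacuity conjunct `Nonempty (HodgeModel n X)` of HodgeConjectureFor, fed to `closes` as hM.
Shared summit item (HolomorphicDefect, AmpleAdicLefschetz, PeriodDeficiency, …); discharged in tree
by Literature.AlgebraicGeometry.HodgeTheory.nonempty_hodgeModel_holds (Serre GAGA §2 analytification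
+ de Rham + Voisin 2002 Prop. 6.11), so a prover closes it in one line from a Theorems file that
imports ComplexConjugationHolds (the route file deliberately does not). [difficulty: S]
[SerreGAGA1956, VoisinHodgeI2002] -/
@[route_item "route-HodgeConjecture-GenericDivisibility", crux]
def HodgeModelsExist : Prop :=
  ∀ (n : ℕ) (X : Literature.AlgebraicGeometry.Motives.SchemeOver ℂ), Literature.AlgebraicGeometry.Motives.IsSmoothProjective n X → Nonempty (Literature.AlgebraicGeometry.HodgeTheory.HodgeModel n X)

/-- item stmt-HodgeConjecture-18468 · support · rank 9 · closed · proved by Summit.HodgeConjecture.HodgeConjecture.Theorems.genericDivisibility_middleConiveauOne_proof @ 6e389023197e (prover) · by planner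
sources: VoisinHodgeI2002, HatcherAT2002
[support] the seam (provable now; proved in the planner's Sketch.lean as `middleConiveauOne`, 10
lines): C1 and C2 give coniveau ≥ 1 for every RATIONAL middle-degree (p,p) class — take an integral
multiple (IsRationalClass.exists_nsmul_isIntegralClass, isIntegralClass_iff_mem_range_ringChange),
apply C1 then C2, divide by the multiple in the ℂ-submodule N¹. [difficulty: provable-now] -/
@[route_item "route-HodgeConjecture-GenericDivisibility", crux]
def MiddleConiveauOne : Prop :=
  open Literature.AlgebraicGeometry.Motives Literature.AlgebraicGeometry.HodgeTheory in HodgeClassesGenericallyDivisible → GenericDivisibilityBounded → ∀ ⦃p : ℕ⦄ ⦃X : SchemeOver ℂ⦄, 1 ≤ p → IsSmoothProjective (2 * p) X → ∀ c : complexBetti X (2 * p), IsRationalClass c → IsOfHodgeType (2 * p) X (2 * p) p p c → c ∈ supportedClasses X (2 * p) 1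

-- earlier TorsionDiesGenerically (stmt-HodgeConjecture-18469, replaced 2026-08-17T03:03:35Z -> stmt-HodgeConjecture-18850): retired by None — open Literature.AlgebraicGeometry.Motives Literature.AlgebraicGeometry.HodgeTheory Literature.AlgebraicTopology.SingularHomology in ∀ ⦃p : ℕ⦄ ⦃X : SchemeOver ℂ⦄, 1 ≤ p → IsSmoothProjective (2 * p) X → ∀ (Z : Set X.left), IsClosed Z → Z ≠ Set.univ → ∀ (w : sing
/-- item stmt-HodgeConjecture-18850 · support · rank 9 · open · by planner
sources: arXiv:1005.2778, doi:10.4007/annals.2011.174.1.11, doi:10.24033/asens.1266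
[support] the Bloch–Kato shadow used by every line on C1 (printed theorem, Colliot-Thélène–Voisin
2012 Thm. 3.1: the Zariski sheaf 𝓗^{2p}(ℤ) is torsion-free): an integral class on the complex points
of a non-empty Zariski open of a smooth projective 2p-fold that is killed by some N ≥ 1 restricts to
zero on the complex points of a smaller non-empty Zariski open. Not in Mathlib or the tree (needs
the norm-residue theorem); filed as a cite request. RESTATED 1:1 (route-repair 2026-08-17, cone
guardrail; Iff.rfl-identical to stmt-HodgeConjecture-18469, checked in DefeqCheck.lean): the
inclusion (X∖Z')(ℂ) ↪ (X∖Z)(ℂ) is spelled inline instead of `complexPointsComplInclusion h`, whose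
module drags AlgebraicClassesCup/HardLefschetzThreefold into the import cone. [difficulty: L]
[arXiv:1005.2778, doi:10.4007/annals.2011.174.1.11, doi:10.24033/asens.1266] -/
@[route_item "route-HodgeConjecture-GenericDivisibility", crux]
def TorsionDiesGenerically : Prop :=
  open Literature.AlgebraicGeometry.Motives Literature.AlgebraicGeometry.HodgeTheory Literature.AlgebraicTopology.SingularHomology in ∀ ⦃p : ℕ⦄ ⦃X : SchemeOver ℂ⦄, 1 ≤ p → IsSmoothProjective (2 * p) X → ∀ (Z : Set X.left), IsClosed Z → Z ≠ Set.univ → ∀ (w : singularCohomology ℤ ℤ (complexPointsCompl X Z) (2 * p)) (N : ℕ), 1 ≤ N → N • w = 0 → ∃ (Z' : Set X.left) (h : Z ⊆ Z'), IsClosed Z' ∧ Z' ≠ Set.univ ∧ singularCohomology.map ℤ ℤ (⟨fun P : complexPointsCompl X Z' => (⟨P.1, fun hP : P.1.pt ∈ Z => P.2 (h hP)⟩ : complexPointsCompl X Z), continuous_subtype_val.subtype_mk fun (P : complexPointsCompl X Z') (hP : P.1.pt ∈ Z) => P.2 (h hP)⟩ : C(complexPointsCompl X Z', complexPointsCompl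 X Z)) (2 * p) w = 0

/-- item stmt-HodgeConjecture-18851 · support · rank 9 · closed · proved by Summit.HodgeConjecture.HodgeConjecture.Theorems.genericDivisibility_divisorInduction_proof @ 38afa42c976e (prover) · by planner
sources: DeligneHodgeIII1974, VoisinHodgeII2003, Thomas2005Nodes
[support] SHARED & PROVED (stmt-HodgeConjecture-1082, Theorems nodalSupport_divisorInduction_proof):
if HC holds in codimension p−1 for smooth projective n-folds, then on a smooth projective (n+1)-fold
every rational (p,p) class of coniveau ≥ 1 (supportedClasses X (2p) 1) is algebraic (Deligne Hodge
III 8.2.8 + semisimplicity + push-forward). In `closes` it replaces the conditional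
HolomorphicDefect descent at the middle degree. [difficulty: proved] -/
@[route_item "route-HodgeConjecture-GenericDivisibility", crux]
def DivisorInduction : Prop :=
  ∀ (n p : ℕ), 1 ≤ p → (∀ ⦃Y : Literature.AlgebraicGeometry.Motives.SchemeOver ℂ⦄, Literature.AlgebraicGeometry.Motives.IsSmoothProjective n Y → ∀ c : Literature.AlgebraicGeometry.HodgeTheory.complexBetti Y (2 * (p - 1)), Literature.AlgebraicGeometry.HodgeTheory.IsRationalClass c → Literature.AlgebraicGeometry.HodgeTheory.IsOfHodgeType n Y (2 * (p - 1)) (p - 1) (p - 1) c → c ∈ Literature.AlgebraicGeometry.HodgeTheory.algebraicClasses Y (p - 1)) → ∀ ⦃X : Literature.AlgebraicGeometry.Motives.SchemeOver ℂ⦄, Literature.AlgebraicGeometry.Motives.IsSmoothProjective (n + 1) X → ∀ c : Literature.AlgebraicGeometry.HodgeTheory.complexBetti X (2 * p), Literature.AlgebraicGeometry.HodgeTheory.IsRationalClass c → Literature.AlgebraicGeometry.HodgeTheory.IsOfHodgeType (n + 1) X (2 * p) p p c → c ∈ Literature.AlgebraicGeometry.HodgeTheory.supportedClasses X (2 * p)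 1 → c ∈ Literature.AlgebraicGeometry.HodgeTheory.algebraicClasses X p

/-- item stmt-HodgeConjecture-18852 · support · rank 9 · closed · proved by Summit.HodgeConjecture.HodgeConjecture.Theorems.genericDivisibility_pencilReduction_proof @ 6e389023197e (prover) · by planner
sources: Thomas2005Nodes, DecataldoMigliorini2009, VoisinHodgeII2003
[support] SHARED & PROVED (stmt-HodgeConjecture-1083, Theorems
linearSystemTorelli_pencilReduction_proof): Lefschetz-pencil reduction below the middle — for 1 ≤ p,
2p ≤ m: HC in all codimensions for smooth projective m-folds and HC in codimension p−1 for
(m+1)-folds imply HC in codimension p for (m+1)-folds (Thomas 2005 Prop. 2; de Cataldo–Migliorini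
2009 Prop. 4.5). `closes` runs it by an inner induction on p. [difficulty: proved] -/
@[route_item "route-HodgeConjecture-GenericDivisibility", crux]
def PencilReduction : Prop :=
  ∀ (m p : ℕ), 1 ≤ p → 2 * p ≤ m → (∀ ⦃Y : Literature.AlgebraicGeometry.Motives.SchemeOver ℂ⦄, Literature.AlgebraicGeometry.Motives.IsSmoothProjective m Y → ∀ (q : ℕ) (c : Literature.AlgebraicGeometry.HodgeTheory.complexBetti Y (2 * q)), Literature.AlgebraicGeometry.HodgeTheory.IsRationalClass c → Literature.AlgebraicGeometry.HodgeTheory.IsOfHodgeType m Y (2 * q) q q c → c ∈ Literature.AlgebraicGeometry.HodgeTheory.algebraicClasses Y q) → (∀ ⦃X' : Literature.AlgebraicGeometry.Motives.SchemeOver ℂ⦄, Literature.AlgebraicGeometry.Motives.IsSmoothProjective (m + 1) X' → ∀ c : Literature.AlgebraicGeometry.HodgeTheory.complexBetti X' (2 * (p - 1)), Literature.AlgebraicGeometry.HodgeTheory.IsRationalClass c → Literature.AlgebraicGeometry.HodgeTheory.IsOfHodgeType (m + 1) X' (2 * (p - 1)) (p - 1) (p - 1) c → c ∈ Literature.AlgebraicGeometry.HodgeTheory.algebraicClasses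 X' (p - 1)) → ∀ ⦃X : Literature.AlgebraicGeometry.Motives.SchemeOver ℂ⦄, Literature.AlgebraicGeometry.Motives.IsSmoothProjective (m + 1) X → ∀ c : Literature.AlgebraicGeometry.HodgeTheory.complexBetti X (2 * p), Literature.AlgebraicGeometry.HodgeTheory.IsRationalClass c → Literature.AlgebraicGeometry.HodgeTheory.IsOfHodgeType (m + 1) X (2 * p) p p c → c ∈ Literature.AlgebraicGeometry.HodgeTheory.algebraicClasses X p

/-- item stmt-HodgeConjecture-18853 · support · rank 9 · closed · proved by Summit.HodgeConjecture.HodgeConjecture.Theorems.genericDivisibility_hardLefschetzReduction_proof @ 6e389023197e (prover) · by planner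
sources: VoisinHodgeI2002, Thomas2005Nodes
[support] SHARED & PROVED (stmt-HodgeConjecture-1084, Theorems
linearSystemTorelli_hardLefschetzReduction_proof): for n < 2p on a smooth projective n-fold, HC in
codimension n−p implies HC in codimension p (hard Lefschetz, Voisin I Thm 6.25; the range p ≥ n is
trivial since algebraicClasses X 0 = ⊤). [difficulty: proved] -/
@[route_item "route-HodgeConjecture-GenericDivisibility", crux]
def HardLefschetzReduction : Prop :=
  ∀ (n p : ℕ), n < 2 * p → ∀ ⦃X : Literature.AlgebraicGeometry.Motives.SchemeOver ℂ⦄, Literature.AlgebraicGeometry.Motives.IsSmoothProjective n X → (∀ c : Literature.AlgebraicGeometry.HodgeTheory.complexBetti X (2 * (n - p)), Literature.AlgebraicGeometry.HodgeTheory.IsRationalClass c → Literature.AlgebraicGeometry.HodgeTheory.IsOfHodgeType n X (2 * (n - p)) (n - p) (n - p) c → c ∈ Literature.AlgebraicGeometry.HodgeTheory.algebraicClasses X (n - p)) → ∀ c : Literature.AlgebraicGeometry.HodgeTheory.complexBetti X (2 * p), Literature.AlgebraicGeometry.HodgeTheory.IsRationalClass c → Literature.AlgebraicGeometry.HodgeTheory.IsOfHodgeType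 n X (2 * p) p p c → c ∈ Literature.AlgebraicGeometry.HodgeTheory.algebraicClasses X p

/-- item stmt-HodgeConjecture-18470 · assembly · rank 1 · closed · proved by Summit.HodgeConjecture.HodgeConjecture.Theorems.genericDivisibility_assembly_proof @ fc74166b4d58 (prover) · by planner
sources: DeligneHodgeIII1974, DecataldoMigliorini2009, BrosnanFangNiePearlstein2009, Deligne2000
[assembly] HodgeClassesGenericallyDivisible → GenericDivisibilityBounded → HodgeConjecture. -/
@[route_item "route-HodgeConjecture-GenericDivisibility"]
def Assembly : Prop :=
  HodgeClassesGenericallyDivisible → GenericDivisibilityBounded → _root_.HodgeConjecture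

/-! D-0027 §2.1 — DECIDING THEOREM (planner-authored via `route open/edit --closes-file`; by planner-rrepair-HodgeConjecture-GenericDivisib-fa905b40-0 2026-08-17T03:03:35Z):
its hypotheses are this route's items and its conclusion the sub-problem Statement (glue_lint), and it elaborates with this file. -/

@[closes "route-HodgeConjecture-GenericDivisibility"] theorem closes (h1 : HodgeClassesGenericallyDivisible) (h2 : GenericDivisibilityBounded)
    (h3 : MiddleConiveauOne) (hM : HodgeModelsExist) (hDiv : DivisorInduction)
    (hP : PencilReduction) (hHL : HardLefschetzReduction) : _root_.HodgeConjecture := by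
  have hmid := h3 h1 h2
  -- strong induction on the dimension
  have key : ∀ M : ℕ, ∀ ⦃n : ℕ⦄, n < M →
      ∀ ⦃X : Literature.AlgebraicGeometry.Motives.SchemeOver ℂ⦄,
        Literature.AlgebraicGeometry.Motives.IsSmoothProjective n X →
          Literature.AlgebraicGeometry.HodgeTheory.HodgeConjectureFor n X := by
    intro M
    induction M with
    | zero => intro n hn; exact absurd hn (Nat.not_lt_zero n)
    | succ M ih =>
      intro n hn X hX
      -- codimension zero, in the dependent form needed for truncated indices
      have zc : ∀ k, k = 0 → ∀ c' : Literature.AlgebraicGeometry.HodgeTheory.complexBetti X (2 * k),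
          c' ∈ Literature.AlgebraicGeometry.HodgeTheory.algebraicClasses X k := by
        rintro k rfl c'
        exact Literature.AlgebraicGeometry.HodgeTheory.hodgeConjectureFor_codim_zero c'
      -- below the middle: the proved pencil reduction, inner strong induction on the codimension
      have below : ∀ (k : ℕ), 2 * k < n →
          ∀ c' : Literature.AlgebraicGeometry.HodgeTheory.complexBetti X (2 * k),
            Literature.AlgebraicGeometry.HodgeTheory.IsRationalClass c' →
            Literature.AlgebraicGeometry.HodgeTheory.IsOfHodgeType n X (2 * k) k k c' →
            c' ∈ Literature.AlgebraicGeometry.HodgeTheory.algebraicClasses X k := by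
        cases n with
        | zero => intro k hk; exact absurd hk (Nat.not_lt_zero _)
        | succ m =>
          have gen : ∀ k, 2 * k ≤ m → ∀ ⦃X' : Literature.AlgebraicGeometry.Motives.SchemeOver ℂ⦄,
              Literature.AlgebraicGeometry.Motives.IsSmoothProjective (m + 1) X' →
              ∀ c' : Literature.AlgebraicGeometry.HodgeTheory.complexBetti X' (2 * k),
                Literature.AlgebraicGeometry.HodgeTheory.IsRationalClass c' →
                Literature.AlgebraicGeometry.HodgeTheory.IsOfHodgeType (m + 1) X' (2 * k) k k c' →
                c' ∈ Literature.AlgebraicGeometry.HodgeTheory.algebraicClasses X' k := by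
            intro k
            induction k using Nat.strong_induction_on with
            | _ k ihk =>
              intro hkm X' hX' c' hc' hpp'
              rcases Nat.eq_zero_or_pos k with rfl | hk
              · exact Literature.AlgebraicGeometry.HodgeTheory.hodgeConjectureFor_codim_zero c'
              · exact hP m k hk hkm
                  (fun Y hY q d hd hqq => (ih (by omega) hY).2 q d hd hqq)
                  (fun X'' hX'' d hd hqq => ihk (k - 1) (by omega) (by omega) hX'' d hd hqq)
                  hX' c' hc' hpp'
          intro k hk c' hc' hpp'
          exact gen k (by omega) hX c' hc' hpp'
      have lowdeg : ∀ k, (2 * k < n ∨ k = 0) →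
          ∀ c' : Literature.AlgebraicGeometry.HodgeTheory.complexBetti X (2 * k),
            Literature.AlgebraicGeometry.HodgeTheory.IsRationalClass c' →
            Literature.AlgebraicGeometry.HodgeTheory.IsOfHodgeType n X (2 * k) k k c' →
            c' ∈ Literature.AlgebraicGeometry.HodgeTheory.algebraicClasses X k := by
        intro k hk c' hc' hpp'
        rcases hk with hk | hk
        · exact below k hk c' hc' hpp'
        · exact zc k hk c'
      refine ⟨hM n X hX, fun p c hc hpp => ?_⟩
      rcases Nat.lt_trichotomy (2 * p) n with hlt | heq | hgt
      · -- below the middle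
        exact below p hlt c hc hpp
      · -- the middle degree: the two cruxes give coniveau ≥ 1, divisor induction gives algebraicity
        cases n with
        | zero => exact zc p (by omega) c
        | succ m =>
          have hp : 1 ≤ p := by omega
          have hX2 := hX
          have hpp2 := hpp
          rw [← heq] at hX2 hpp2
          have hsupp : c ∈ Literature.AlgebraicGeometry.HodgeTheory.supportedClasses X (2 * p) 1 :=
            hmid hp hX2 c hc hpp2
          exact hDiv m p hp (fun Y hY d hd hqq => (ih (by omega) hY).2 (p - 1) d hd hqq)
            hX c hc hpp hsupp
      · -- above the middle: hard Lefschetz from codimension n - p (below the middle or zero)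
        exact hHL n p hgt hX (lowdeg (n - p) (by omega)) c hc hpp
  intro n X hX
  exact key (n + 1) (Nat.lt_succ_self n) hX

end Summit.HodgeConjecture.HodgeConjecture.Theses.GenericDivisibility
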